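import Literature.Analysis.TotalPositivity.PolyaFrequencyFunctions
import Literature.Analysis.TotalPositivity.PolyaFrequencyGaussian
import Literature.NumberTheory.LFunctions.DeBruijnNewmanProofs
import Literature.NumberTheory.LFunctions.DobnerLemma4Proofs
import Mathlib.MeasureTheory.Integral.Prod
import HarnessLib

/-!
# Barrier: no Pólya-frequency smoothing of `H_0` at a fixed scale is real-rooted
# (generalised Newman on de Bruijn's finite even universal-factor cone)

Barrier catalogue `Literature/Barriers/RiemannHypothesis/` (D-0021), entry `PolyaFrequencySmoothing`
(namespace `Literature.Barriers.RiemannHypothesis`).  It is the convolution-language form of the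
no-go which route `Summits/RiemannHypothesis/RiemannHypothesis/Theses/UniversalFactor.lean` calls
`UniversalFactorNewman`, and it extends the catalogued Gaussian entry `NewmanConjecture` (`Λ ≥ 0`).

## The technique (Schoenberg 1947/1951; Pólya 1927 via Newman–Wu 2020; Cardon 2001)

With `Φ = deBruijnPhi` and `H_0(z) = ∫₀^∞ Φ(u) cos(zu) du = ξ(1/2 + iz/2)/8`
(`Literature.NumberTheory.LFunctions.deBruijnH 0`), RH says that `H_0` has only real zeros.  Let `Λ`
be an EVEN Pólya frequency function (`Literature.Analysis.TotalPositivity.IsPolyaFrequencyFun`).  By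
Schoenberg's theorem [Schoenberg1947, Thms. 1–2; Schoenberg1951, restated in SchoenbergWhitney1953,
(6)–(7)] — in the tree `Literature.Analysis.TotalPositivity.schoenberg1951_pf_laplace`, PROVED — its
bilateral Laplace transform is `1/Ψ(s)` on a strip `α < Re s < β`, `α < 0 < β`, with `Ψ` an entire
function of Laguerre–Pólya type II [Schoenberg1947, §2 eq. (9)]; for even `Λ` with finitely many
factors, `Ψ(s) = C e^{−γs²} ∏_{b∈S} (1 − s²/b²)` (`HasFiniteEvenSchoenbergForm`).  The differential
operator `T = Ψ(D)` preserves real-rootedness of real entire functions of order `< 2`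
(Hermite–Poulain–Pólya; `φ(u) = Ψ(iu) = C e^{γu²}∏(1 + u²/b²)` is a *universal factor* in Pólya's
sense [NewmanWu2020, §2.2 Thm. 2: "`φ` is a universal factor if and only if … `φ(iz)` is an entire
function of the form (LP)"; examples `e^{Bt²}`, `cosh at`]), and `T⁻¹` is convolution with `Λ`:
`T(Λ ∗ H_0) = H_0`.  So the PF-SMOOTHING ROUTE to RH is: *find one such `Λ` (one scale, one finite
even `Ψ`) with `Λ ∗ H_0` real-rooted*.  In Cardon's words [Cardon2001, §3 Question 7, p. 1733]: "Can
the function `Ξ(t) = ξ(1/2 + it)` be realized as a convolution `Ξ(t) = (G ∗ dF)(t)` where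
`G(t) ∈ 𝓛𝓟*`?  This would prove the Riemann Hypothesis!  However, it seems unlikely that this
approach would be fruitful …".

## The dictionary (proved here) and the obstruction

`pfSmoothing_eq` (Fubini + the Laplace transform on the imaginary axis `s = ±iu`, inside the strip):
for every `Λ` with reciprocal transform `Ψ` of finite even Schoenberg form `(C, γ, S)`,
`(Λ ∗ H_0)(z) = ∫ℝ Λ(y) H_0(z − y) dy = C⁻¹ ∫₀^∞ e^{−γu²} Φ(u) / ∏_{b∈S}(1 + u²/b²) · cos(zu) du`
— the de Bruijn transform of `Φ` DIVIDED by the universal factor `φ = Ψ(i·)`.  Hence: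
* Gaussian ray (`S = ∅`, `γ > 0`): `Λ ∗ H_0 = C⁻¹ H_{−γ}`, which has a non-real zero by `Λ ≥ 0`
  [RodgersTaoFMP2020, Thm. 1.1] — in the tree `Literature.NumberTheory.LFunctions.rodgers_tao_holds`
  (proved along Dobner); so this ray of the barrier is a THEOREM here
  (`not_hasOnlyRealZeros_pfSmoothing_gaussian`);
* Laplace rays (`S ≠ ∅`): generalised Newman on the finite cone is a theorem OF THE TREE, not of print:
  `Summit.RiemannHypothesis.RiemannHypothesis.Theorems.UniversalFactor.not_laplaceLoophole_iff_universalFactorNewman`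
  `.mp Summit.RiemannHypothesis.RiemannHypothesis.Theorems.UniversalFactorLaplaceLoophole_refuted`
  (2026-08-16; kernel-checked; the finite-even-factor form of Cardon's Question 7, answered in the
  negative).  Literature cannot import `Summits.*`, so the barrier is recorded as the named fact
  `PolyaFrequencySmoothing` together with the reduction
  `PolyaFrequencySmoothing_of_universalFactorNewman`, whose hypothesis is LITERALLY the right-hand side
  of that summit-side equivalence: the discharge `PolyaFrequencySmoothing_holds` is a one-line
  summit-side theorem (`Theorems/`, prover-owned).

Design: stated over existing vocabulary only (`IsPolyaFrequencyFun`, `HasLaplaceTransformInvOn`,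
`deBruijnH`, `HasOnlyRealZeros`); new are the predicate `HasFiniteEvenSchoenbergForm` (the sub-case
`δ = 0`, `δ_ν` in pairs `±1/b`, finitely many, of `HasSchoenbergForm` (7)) and the barrier.  Evenness
and total positivity of `Λ` belong to the technique class, not to the proof, which uses only the
transform identity on `Re s = 0`.  Non-vacuity: `exists_hypotheses_polyaFrequencySmoothing`.
Not here (see `scope_caveats`): infinite even products, Pólya's Hermitian non-even universal
factors (the linear-factor route of `NewmanConjecture.lean`, last section), the Mellin/Euler ray.

## References

* [Schoenberg1947] I. J. Schoenberg, PNAS 33 (1947) 11–17 (read: §2 (8)–(9), §3 Thms. 1–2).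
* [Schoenberg1951] J. Analyse Math. 1 (1951); [SchoenbergWhitney1953] Trans. AMS 74 (1953), Intro.
  (6)–(7) — as vendored in `Literature/Analysis/TotalPositivity/PolyaFrequencyFunctions.lean`.
* [NewmanWu2020] C. M. Newman, W. Wu, Bull. AMS 57 (2020) = arXiv:1901.06596 (read: §2.2 Thm. 2
  and examples; §2.3).
* [Cardon2001] D. A. Cardon, Proc. AMS 130 (2002) 1725–1734 (read: §1 Thms. 1–2; §3 Q. 7, p. 1733).
* [RodgersTaoFMP2020] B. Rodgers, T. Tao, Forum Math. Pi 8 (2020), Thm. 1.1 (`Λ ≥ 0`).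
* [Bruijn1950] N. G. de Bruijn, Duke Math. J. 17 (1950) (universal factors; as cited in
  `Literature/NumberTheory/LFunctions/DeBruijnNewman.lean`).
-/

noncomputable section

open MeasureTheory Set Filter Literature.NumberTheory.LFunctions Literature.Analysis.TotalPositivity

namespace Literature.Barriers.RiemannHypothesis

/-! ## The technique class: finite even Schoenberg forms -/

/-- **Finite even Schoenberg form**: `Ψ(s) = C e^{−γs²} ∏_{b∈S} (1 − s²/b²)` with `C > 0`, `γ ≥ 0`,
`S` a finite multiset of positive reals, and `S ≠ ∅` or `γ > 0` (not the trivial `Ψ ≡ C`).  This is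
Schoenberg's type II `Ψ(z) = C e^{−γz²+δz} ∏ (1 + δ_ν z) e^{−δ_ν z}` [Schoenberg1947, §2 eq. (9)] =
eq. (7) of `HasSchoenbergForm`, in the EVEN case `δ = 0`, `δ_ν` in pairs `±1/b`
(`(1 + s/b)e^{−s/b}(1 − s/b)e^{s/b} = 1 − s²/b²`), with finitely many factors; on the imaginary
axis `Ψ(iu) = C e^{γu²} ∏ (1 + u²/b²)` is de Bruijn's real even universal factor.
[cite: Schoenberg1947, §2 eq. (9) and §3 Thms. 1–2] [cite: SchoenbergWhitney1953, Introduction eq. (7)] -/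
def HasFiniteEvenSchoenbergForm (Ψ : ℂ → ℂ) : Prop :=
  ∃ (C γ : ℝ) (S : Multiset ℝ), 0 < C ∧ 0 ≤ γ ∧ (∀ b ∈ S, 0 < b) ∧ (S ≠ 0 ∨ 0 < γ) ∧
    ∀ s : ℂ, Ψ s = (C : ℂ) * Complex.exp (-(γ : ℂ) * s ^ 2) *
      (S.map fun b : ℝ => 1 - s ^ 2 / (b : ℂ) ^ 2).prod

/-- A function of finite even Schoenberg form is even. [folklore] -/
theorem HasFiniteEvenSchoenbergForm.neg_apply {Ψ : ℂ → ℂ} (h : HasFiniteEvenSchoenbergForm Ψ)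
    (s : ℂ) : Ψ (-s) = Ψ s := by
  obtain ⟨C, γ, S, -, -, -, -, hΨ⟩ := h
  rw [hΨ, hΨ, neg_sq]

/-! ## The barrier -/

/-- **Barrier `PolyaFrequencySmoothing` — no Pólya-frequency smoothing of `H_0` at a fixed scale is
real-rooted.**  For every even Pólya frequency function `Λ` whose bilateral Laplace transform is
`1/Ψ` on a strip `α < Re s < β` about `0` with `Ψ(s) = C e^{−γs²}∏_{b∈S}(1 − s²/b²)` of finite even
Schoenberg form, the smoothed function `(Λ ∗ H_0)(z) = ∫ℝ Λ(y) H_0(z − y) dy` has a NON-REAL zero.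
Equivalently (`pfSmoothing_eq`): for every `γ ≥ 0` and finite multiset `S` of positive rates,
`S ≠ ∅ ∨ γ > 0`, the divided transform `∫₀^∞ e^{−γu²}Φ(u)/∏(1 + u²/b²) cos(zu) du` is not
real-rooted — generalised Newman on de Bruijn's finite even universal-factor cone.  PROVED: the
Gaussian ray `S = ∅` in this file (`not_hasOnlyRealZeros_pfSmoothing_gaussian`, from `Λ ≥ 0`
[cite: RodgersTaoFMP2020, Thm. 1.1], `Literature.NumberTheory.LFunctions.rodgers_tao_holds`); the
rays `S ≠ ∅` summit-side only (kernel-checked 2026-08-16,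
`Summit.RiemannHypothesis.RiemannHypothesis.Theorems.UniversalFactor.not_laplaceLoophole_iff_universalFactorNewman`
with `…Theorems.UniversalFactorLaplaceLoophole_refuted`; NOT in print, where the question — for
Cardon's kernels `dF` — is posed without answer [cite: Cardon2001, §3 Question 7, p. 1733]).  Literature cannot import `Summits.*`: this is
a named fact whose discharge is `PolyaFrequencySmoothing_of_universalFactorNewman` applied to that
summit theorem.

BARRIER (structured block, D-0021):
- technique_class: PF-smoothing / universal-factor division / inverse-hyperbolicity-preserver real-rooting of `Ξ`: write `H_0 = T F` with `T = Ψ(D)` a finite even Laguerre–Pólya multiplier (`Ψ` of `HasFiniteEvenSchoenbergForm`; `T` preserves real-rootedness, `φ = Ψ(i·)` a universal factor [cite: NewmanWu2020, §2.2 Thm. 2]) and `F = T⁻¹H_0 = Λ ∗ H_0`, `Λ` the even Pólya frequency density with transform `1/Ψ` [cite: Schoenberg1947, §3 Thms. 1–2] (tree: `Literature.Analysis.TotalPositivity.schoenberg1951_pf_laplace`, proved), and prove `F` real-rooted — Cardon's convolution question [cite: Cardon2001, §3 Question 7]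
- blocks: RiemannHypothesis via "`T` hyperbolicity-preserving ∧ `T⁻¹H_0` has only real zeros" for any fixed finite even `T ≠ const` — de Bruijn's Gaussian factor `e^{λu²}` (route `DeBruijnRoute` of the catalogued `Λ ≥ 0` entry) [cite: RodgersTaoFMP2020, §1], the Laplace factors `1 + u²/a²` and all their finite products (route `UniversalFactor`, target `LaplaceLoophole`, and every idea of the form "`Ξ = T[F]`, `T` a non-trivial finite even universal-factor operator, `F` provably Laguerre–Pólya") [cite: Cardon2001, §3 Question 7]
- because: `Λ ∗ H_0 = C⁻¹∫₀^∞ e^{−γu²}Φ(u)/∏(1 + u²/b²) cos(zu) du` (`pfSmoothing_eq`, this file); on the Gaussian ray this is `C⁻¹H_{−γ}`, not real-rooted for `γ > 0` by `Λ ≥ 0` — the zeros of `H_t`, `t < 0`, would relax to local equilibrium, against the pair correlation of zeta zeros [cite: RodgersTaoFMP2020, Thm. 1.1 and §1]; on the Laplace rays (IN THE TREE, not in print): a mixed factor reduces to a single Laplace factor `F_a` by hyperbolicity preservation of the remaining factors, and `F_a = (a/2)∫e^{−a|y|}H_0(· − y) dy` has a non-real zero for every `a > 0` — wide `a < π/8`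 by the residue of `Φ` at `u = ia` (one-signed exponential tails plus growth along `iℝ`), `π/8 ≤ a ≤ 32` by kernel-checked one-point Laguerre certificates at close pairs of zeta zeros (Lehmer pairs), `a ≥ 32` by a log-free energy gap for the Lorentz-filtered Hardy function, `L²`-pigeonhole and two-step Laguerre interlacing (`Summit.RiemannHypothesis.RiemannHypothesis.Theorems.UniversalFactorLaplaceLoophole_refuted`) [cite: Cardon2001, §3 Question 7 ("it seems unlikely that this approach would be fruitful")]
- evasions_known: none published reaching RH.  Not evasions but outside the wall: the FORWARD (preserver) direction — multiplying `Φ` by a universal factor and following thresholds (`Λ ≤ 0.2`, de Bruijn–Newman flow) [cite: NewmanWu2020, §2.2–2.3] — whose vertex is RH itself; and the factor classes listed under `scope_caveats`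
- scope_caveats: certified for FINITE EVEN `Ψ` only (Gaussian ray: published theorem; Laplace rays: tree theorems, unpublished).  NOT covered: (i) even `Ψ` of type II with infinitely many zeros (infinite products `∏(1 − s²/b_ν²)`, `Σ b_ν⁻² < ∞`) — would follow from a universal-factor theorem for genus-1 even products, not in the tree; (ii) Pólya's Hermitian non-even universal factors `φ(u) = Ψ(iu)`, `Ψ` with a real zero `b` but not `−b` (one-sided exponential kernels, `T = 1 − D/b`): these imply only the linear-factor route `∃ a ≠ 0, HasOnlyRealZeros (linearFactorH a)` (`Literature.Barriers.RiemannHypothesis.linearFactorH`, last section of the `Λ ≥ 0` entry's file), proved or refuted nowhere as a whole; (iii) non-convolution deformations (Mellin/Euler averages `∫₀¹ v^{c−1}H_0(zv) dv`, multiplier sequences, Poisson flows) — untouched; (iv) Cardon's own kernels `dF` [cite: Cardon2001, Thm. 1] (limits of Rademacher sums `Σ aᵢXᵢ/s_n`, vertical shifts `∫G(z − is) dF(s)`, i.e. factors `M(u) = ∏ cosh(aᵢu/s_n)` and their normal limit): the normal limit is the Gaussian ray (covered); a `cosh` factor is an INFINITE Laplace product `cosh(au) = ∏_k (1 + 4a²u²/((2k−1)²π²))`,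 so Question 7 for it reaches the Laplace ray `b = π/(2a)` only through one more universal-factor step of type (i), not in the tree; Cardon's Thm. 1 itself (the forward direction) is not restricted by this entry
- status: established (Gaussian ray [cite: RodgersTaoFMP2020, Thm. 1.1]; finite Laplace rays: the kernel-checked tree theorems named above; no dissent in print)

[cite: RodgersTaoFMP2020, Thm. 1.1] [cite: Cardon2001, §3 Question 7, p. 1733] -/
def PolyaFrequencySmoothing : Prop :=
  ∀ (Λ : ℝ → ℝ) (Ψ : ℂ → ℂ) (α β : ℝ), IsPolyaFrequencyFun Λ → (∀ x, Λ (-x) = Λ x) →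
    HasLaplaceTransformInvOn Λ Ψ α β → α < 0 → 0 < β → HasFiniteEvenSchoenbergForm Ψ →
      ¬ HasOnlyRealZeros (fun z : ℂ => ∫ y : ℝ, (Λ y : ℂ) * deBruijnH 0 (z - y))

/-! ## The dictionary: `Λ ∗ H_0` is the transform of `Φ` divided by the universal factor `Ψ(i·)` -/

variable {Λ : ℝ → ℝ} {Ψ : ℂ → ℂ} {α β : ℝ}

/-- `H_0(w) = ∫₀^∞ Φ(u) cos(wu) du` (the weight `e^{0·u²}` removed; Literature home of the summit-side
helper of the same name in `Theorems/UniversalFactorLaplaceLoopholeConvolution.lean`). [folklore] -/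
theorem deBruijnH_zero_eq_integral_cos (w : ℂ) :
    deBruijnH 0 w = ∫ u in Ioi (0:ℝ), ((deBruijnPhi u : ℝ) : ℂ) * Complex.cos (w * u) := by
  rw [deBruijnH]
  refine setIntegral_congr_fun measurableSet_Ioi fun u _ => ?_
  simp

/-- A function with a reciprocal Laplace transform on a strip about `Re s = 0` is integrable
(the case `s = 0` of `HasLaplaceTransformInvOn`). [folklore] -/
theorem integrable_ofReal_of_hasLaplaceTransformInvOn (hL : HasLaplaceTransformInvOn Λ Ψ α β)
    (hα : α < 0) (hβ : 0 < β) : Integrable fun y : ℝ => ((Λ y : ℝ) : ℂ) := by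
  have h := (hL 0 (by simpa using hα) (by simpa using hβ)).1
  simpa using h

/-- **Fubini for a general integrable kernel**:
`∫ℝ Λ(y) H_0(z − y) dy = ∫₀^∞ Φ(u) (∫ℝ Λ(y) cos((z − y)u) dy) du`, the double integral converging
absolutely because `|cos((z − y)u)| ≤ e^{|Im z|u}` and `Φ(u)e^{|Im z|u}` is integrable
(`integrableOn_deBruijnHBound`). [folklore] -/
theorem integral_mul_deBruijnH_zero_sub (hΛ : Integrable fun y : ℝ => ((Λ y : ℝ) : ℂ)) (z : ℂ) :
    ∫ y : ℝ, ((Λ y : ℝ) : ℂ) * deBruijnH 0 (z - y) =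
      ∫ u in Ioi (0:ℝ), ((deBruijnPhi u : ℝ) : ℂ) *
        ∫ y : ℝ, ((Λ y : ℝ) : ℂ) * Complex.cos ((z - y) * u) := by
  set G : ℝ → ℝ → ℂ := fun u y =>
    ((deBruijnPhi u : ℝ) : ℂ) * Complex.cos ((z - y) * u) * ((Λ y : ℝ) : ℂ) with hG
  have hint : Integrable (Function.uncurry G) ((volume.restrict (Ioi (0:ℝ))).prod volume) := by
    rw [Function.uncurry_def]
    have hB : Integrable (deBruijnHBound 0 |z.im|) (volume.restrict (Ioi (0:ℝ))) :=
      integrableOn_deBruijnHBound 0 |z.im|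
    refine (hB.mul_prod hΛ.norm).mono' ?_ ?_
    · have h1 : AEStronglyMeasurable (fun p : ℝ × ℝ => ((deBruijnPhi p.1 : ℝ) : ℂ))
          ((volume.restrict (Ioi (0:ℝ))).prod volume) := by
        have h0 : AEStronglyMeasurable (fun u : ℝ => ((deBruijnPhi u : ℝ) : ℂ))
            (volume.restrict (Ioi (0:ℝ))) :=
          Complex.continuous_ofReal.comp_aestronglyMeasurable
            ((continuousOn_deBruijnPhi_Ici.mono Ioi_subset_Ici_self).aestronglyMeasurable
              measurableSet_Ioi)
        exact h0.comp_fst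
      have h2 : Continuous fun p : ℝ × ℝ => Complex.cos ((z - p.2) * p.1) := by fun_prop
      have h3 : AEStronglyMeasurable (fun p : ℝ × ℝ => ((Λ p.2 : ℝ) : ℂ))
          ((volume.restrict (Ioi (0:ℝ))).prod volume) := hΛ.aestronglyMeasurable.comp_snd
      exact (h1.mul h2.aestronglyMeasurable).mul h3
    · have hre : (volume.restrict (Ioi (0:ℝ))).prod (volume : Measure ℝ) =
          ((volume : Measure ℝ).prod (volume : Measure ℝ)).restrict (Ioi (0:ℝ) ×ˢ univ) := by
        rw [← Measure.prod_restrict, Measure.restrict_univ]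
      rw [hre]
      refine ae_restrict_of_forall_mem (measurableSet_Ioi.prod MeasurableSet.univ) fun p hp => ?_
      have hu : 0 < p.1 := hp.1
      have hI : ‖((deBruijnPhi p.1 : ℝ) : ℂ) * Complex.cos ((z - p.2) * p.1)‖ ≤
          deBruijnHBound 0 |z.im| p.1 := by
        have := norm_deBruijnHIntegrand_le (t := 0) (T := 0) (Y := |z.im|) (z := z - p.2) le_rfl
          (by simp) hu.le
        simpa [deBruijnHIntegrand] using this
      show ‖((deBruijnPhi p.1 : ℝ) : ℂ) * Complex.cos ((z - p.2) * p.1) * ((Λ p.2 : ℝ) : ℂ)‖ ≤ _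
      rw [norm_mul]
      exact mul_le_mul_of_nonneg_right hI (norm_nonneg _)
  have hu : ∀ y : ℝ, ∫ u in Ioi (0:ℝ), G u y = ((Λ y : ℝ) : ℂ) * deBruijnH 0 (z - y) := by
    intro y
    simp only [hG]
    rw [integral_mul_const, deBruijnH_zero_eq_integral_cos]
    exact mul_comm _ _
  have hy : ∀ u : ℝ, ∫ y : ℝ, G u y =
      ((deBruijnPhi u : ℝ) : ℂ) * ∫ y : ℝ, ((Λ y : ℝ) : ℂ) * Complex.cos ((z - y) * u) := by
    intro u
    simp only [hG]
    rw [← integral_const_mul]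
    refine integral_congr_ae (Eventually.of_forall fun y => ?_)
    ring
  calc ∫ y : ℝ, ((Λ y : ℝ) : ℂ) * deBruijnH 0 (z - y)
      = ∫ y : ℝ, ∫ u in Ioi (0:ℝ), G u y :=
        integral_congr_ae (Eventually.of_forall fun y => (hu y).symm)
    _ = ∫ u in Ioi (0:ℝ), ∫ y : ℝ, G u y := (integral_integral_swap hint).symm
    _ = _ := integral_congr_ae (Eventually.of_forall hy)

/-- **The inner integral from the Laplace transform on the imaginary axis**: for `s = ±iu` inside
the strip, `∫ℝ Λ(y) cos((z − y)u) dy = (e^{izu}/Ψ(iu) + e^{−izu}/Ψ(−iu))/2`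
(`cos((z−y)u) = (e^{izu}e^{−y·iu} + e^{−izu}e^{−y·(−iu)})/2` and `∫ e^{−ys}Λ(y) dy = 1/Ψ(s)`).
[folklore] -/
theorem integral_mul_cos_sub_mul (hL : HasLaplaceTransformInvOn Λ Ψ α β) (hα : α < 0) (hβ : 0 < β)
    (z : ℂ) (u : ℝ) :
    ∫ y : ℝ, ((Λ y : ℝ) : ℂ) * Complex.cos ((z - y) * u) =
      (Complex.exp (Complex.I * z * u) / Ψ (Complex.I * u) +
        Complex.exp (-(Complex.I * z * u)) / Ψ (-(Complex.I * u))) / 2 := by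
  obtain ⟨hi₁, -, he₁⟩ := hL (Complex.I * u) (by simpa using hα) (by simpa using hβ)
  obtain ⟨hi₂, -, he₂⟩ := hL (-(Complex.I * u)) (by simpa using hα) (by simpa using hβ)
  have hcos : ∀ y : ℝ, ((Λ y : ℝ) : ℂ) * Complex.cos ((z - y) * u) =
      (1 / 2 : ℂ) * (Complex.exp (Complex.I * z * u) *
          (Complex.exp (-(y : ℂ) * (Complex.I * u)) * ((Λ y : ℝ) : ℂ)) +
        Complex.exp (-(Complex.I * z * u)) *
          (Complex.exp (-(y : ℂ) * -(Complex.I * u)) * ((Λ y : ℝ) : ℂ))) := by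
    intro y
    have e1 : Complex.exp (Complex.I * z * u) * Complex.exp (-(y : ℂ) * (Complex.I * u)) =
        Complex.exp ((z - y) * u * Complex.I) := by rw [← Complex.exp_add]; congr 1; ring
    have e2 : Complex.exp (-(Complex.I * z * u)) * Complex.exp (-(y : ℂ) * -(Complex.I * u)) =
        Complex.exp (-((z - y) * u) * Complex.I) := by rw [← Complex.exp_add]; congr 1; ring
    have hc : Complex.cos ((z - y) * u) =
        (Complex.exp (Complex.I * z * u) * Complex.exp (-(y : ℂ) * (Complex.I * u)) +
          Complex.exp (-(Complex.I * z * u)) * Complex.exp (-(y : ℂ) * -(Complex.I * u))) / 2 := by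
      rw [e1, e2, Complex.cos]
    rw [hc]
    ring
  simp_rw [hcos]
  rw [integral_const_mul, integral_add (hi₁.const_mul _) (hi₂.const_mul _), integral_const_mul,
    integral_const_mul, he₁, he₂]
  ring

/-- For EVEN `Ψ` the inner integral is `cos(zu)/Ψ(iu)`. [folklore] -/
theorem integral_mul_cos_sub_mul_of_even (hL : HasLaplaceTransformInvOn Λ Ψ α β) (hα : α < 0)
    (hβ : 0 < β) (hΨ : ∀ s : ℂ, Ψ (-s) = Ψ s) (z : ℂ) (u : ℝ) :
    ∫ y : ℝ, ((Λ y : ℝ) : ℂ) * Complex.cos ((z - y) * u) =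
      Complex.cos (z * u) / Ψ (Complex.I * u) := by
  rw [integral_mul_cos_sub_mul hL hα hβ, hΨ, Complex.cos]
  have e1 : Complex.I * z * u = z * u * Complex.I := by ring
  have e2 : -(z * (u : ℂ) * Complex.I) = -(z * u) * Complex.I := by ring
  rw [e1, e2]
  ring

/-- Casting a finite product over a multiset from `ℝ` to `ℂ`. [folklore] -/
theorem ofReal_multiset_map_prod (S : Multiset ℝ) (f : ℝ → ℝ) :
    (((S.map f).prod : ℝ) : ℂ) = (S.map fun b => ((f b : ℝ) : ℂ)).prod := by
  induction S using Multiset.induction_on with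
  | empty => simp
  | cons b S ih => simp [ih]

/-- **A finite even Schoenberg form on the imaginary axis is de Bruijn's universal factor**:
`Ψ(iu) = C e^{γu²} ∏_{b∈S} (1 + u²/b²)` (real, `≥ C > 0`). [folklore] -/
theorem finiteEvenSchoenbergForm_I_mul {C γ : ℝ} {S : Multiset ℝ}
    (hΨ : ∀ s : ℂ, Ψ s = (C : ℂ) * Complex.exp (-(γ : ℂ) * s ^ 2) *
      (S.map fun b : ℝ => 1 - s ^ 2 / (b : ℂ) ^ 2).prod) (u : ℝ) :
    Ψ (Complex.I * u) =
      ((C * Real.exp (γ * u ^ 2) * (S.map fun b => 1 + u ^ 2 / b ^ 2).prod : ℝ) : ℂ) := by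
  have hsq : (Complex.I * (u : ℂ)) ^ 2 = -(u : ℂ) ^ 2 := by
    rw [mul_pow, Complex.I_sq]; ring
  have h1 : -(γ : ℂ) * -(u : ℂ) ^ 2 = ((γ * u ^ 2 : ℝ) : ℂ) := by push_cast; ring
  have h2 : (S.map fun b : ℝ => 1 - -(u : ℂ) ^ 2 / (b : ℂ) ^ 2) =
      S.map fun b => (((1 + u ^ 2 / b ^ 2 : ℝ)) : ℂ) :=
    Multiset.map_congr rfl fun b _ => by push_cast; ring
  rw [hΨ, hsq, h1, h2, ← Complex.ofReal_exp, ← ofReal_multiset_map_prod]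
  simp only [Complex.ofReal_mul]

/-- **The dictionary.**  If the bilateral Laplace transform of `Λ` is `1/Ψ` on a strip about
`Re s = 0` and `Ψ(s) = C e^{−γs²}∏_{b∈S}(1 − s²/b²)`, then for every complex `z`
`∫ℝ Λ(y) H_0(z − y) dy = C⁻¹ ∫₀^∞ e^{−γu²} Φ(u) / ∏_{b∈S}(1 + u²/b²) · cos(zu) du`:
PF-smoothing of `H_0` by `Λ` is division of de Bruijn's kernel `Φ` by the universal factor
`Ψ(iu)`.  (Only the transform identity on `Re s = 0` is used; the right-hand integrand is written
exactly as in route `UniversalFactor`'s item `MixedFactorReduction`.) [folklore] -/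
theorem pfSmoothing_eq (hL : HasLaplaceTransformInvOn Λ Ψ α β) (hα : α < 0) (hβ : 0 < β)
    {C γ : ℝ} {S : Multiset ℝ}
    (hΨ : ∀ s : ℂ, Ψ s = (C : ℂ) * Complex.exp (-(γ : ℂ) * s ^ 2) *
      (S.map fun b : ℝ => 1 - s ^ 2 / (b : ℂ) ^ 2).prod) (z : ℂ) :
    ∫ y : ℝ, ((Λ y : ℝ) : ℂ) * deBruijnH 0 (z - y) =
      (C : ℂ)⁻¹ * ∫ u in Set.Ioi (0:ℝ), ((Real.exp (-(γ * u ^ 2)) * deBruijnPhi u /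
        (S.map fun b => 1 + u ^ 2 / b ^ 2).prod : ℝ) : ℂ) * Complex.cos (z * u) := by
  have heven : ∀ s : ℂ, Ψ (-s) = Ψ s := fun s => by rw [hΨ, hΨ, neg_sq]
  rw [integral_mul_deBruijnH_zero_sub (integrable_ofReal_of_hasLaplaceTransformInvOn hL hα hβ) z,
    ← integral_const_mul]
  refine setIntegral_congr_fun measurableSet_Ioi fun u _ => ?_
  rw [integral_mul_cos_sub_mul_of_even hL hα hβ heven z u, finiteEvenSchoenbergForm_I_mul hΨ u,
    Real.exp_neg]
  push_cast
  ring

/-! ## Zeros -/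

/-- A non-zero constant multiple has the same zeros. [folklore] -/
theorem hasOnlyRealZeros_const_mul_iff {c : ℂ} (hc : c ≠ 0) (f : ℂ → ℂ) :
    HasOnlyRealZeros (fun z => c * f z) ↔ HasOnlyRealZeros f := by
  simp [HasOnlyRealZeros, mul_eq_zero, hc]

/-- **The Gaussian ray of the barrier is a theorem**: if the reciprocal transform of `Λ` is the
pure Gaussian `Ψ(s) = C e^{−γs²}`, `C > 0`, `γ > 0` (e.g. `Λ` a centred normal density), then
`Λ ∗ H_0 = C⁻¹ H_{−γ}` has a non-real zero, by `Λ ≥ 0`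
(`Literature.NumberTheory.LFunctions.rodgers_tao_holds`). [cite: RodgersTaoFMP2020, Thm. 1.1] -/
theorem not_hasOnlyRealZeros_pfSmoothing_gaussian (hL : HasLaplaceTransformInvOn Λ Ψ α β)
    (hα : α < 0) (hβ : 0 < β) {C γ : ℝ} (hC : 0 < C) (hγ : 0 < γ)
    (hΨ : ∀ s : ℂ, Ψ s = (C : ℂ) * Complex.exp (-(γ : ℂ) * s ^ 2)) :
    ¬ HasOnlyRealZeros (fun z : ℂ => ∫ y : ℝ, (Λ y : ℂ) * deBruijnH 0 (z - y)) := by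
  have hΨ' : ∀ s : ℂ, Ψ s = (C : ℂ) * Complex.exp (-(γ : ℂ) * s ^ 2) *
      ((0 : Multiset ℝ).map fun b : ℝ => 1 - s ^ 2 / (b : ℂ) ^ 2).prod := fun s => by
    rw [hΨ]; simp
  have hfun : (fun z : ℂ => ∫ y : ℝ, (Λ y : ℂ) * deBruijnH 0 (z - y)) =
      fun z => (C : ℂ)⁻¹ * deBruijnH (-γ) z := by
    funext z
    rw [pfSmoothing_eq hL hα hβ hΨ' z, deBruijnH]
    congr 1
    refine setIntegral_congr_fun measurableSet_Ioi fun u _ => ?_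
    simp only [Multiset.map_zero, Multiset.prod_zero, div_one, neg_mul]
    push_cast
    ring
  intro hreal
  rw [hfun, hasOnlyRealZeros_const_mul_iff (inv_ne_zero (Complex.ofReal_ne_zero.2 hC.ne'))]
    at hreal
  exact rodgers_tao_holds (-γ) (by linarith) hreal

/-- **Reduction of the barrier to generalised Newman on the Laplace rays.**  The Gaussian ray
being a theorem here (`not_hasOnlyRealZeros_pfSmoothing_gaussian`), it suffices to know that for
`t ≥ 0` and every NON-EMPTY finite multiset `s` of positive rates the divided transform
`∫₀^∞ e^{−tu²}Φ(u)/∏_{b∈s}(1 + u²/b²) cos(zu) du` has a non-real zero (in the tree: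
`Summit.RiemannHypothesis.RiemannHypothesis.Theorems.UniversalFactorLaplaceLoophole_refuted` with
`…Theses.UniversalFactor.MixedFactorReduction_holds`; not in print).  Proof: `pfSmoothing_eq` and
`hasOnlyRealZeros_const_mul_iff`. [folklore] -/
theorem PolyaFrequencySmoothing_of_laplaceRays
    (hGN : ∀ (t : ℝ) (s : Multiset ℝ), 0 ≤ t → (∀ b ∈ s, 0 < b) → s ≠ 0 →
      ¬ HasOnlyRealZeros (fun z : ℂ => ∫ u in Set.Ioi (0:ℝ), ((Real.exp (-(t * u ^ 2)) *
        deBruijnPhi u / (s.map fun b => 1 + u ^ 2 / b ^ 2).prod : ℝ) : ℂ) *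
          Complex.cos (z * u))) :
    PolyaFrequencySmoothing := by
  rintro Λ Ψ α β - - hL hα hβ ⟨C, γ, S, hC, hγ, hS, hSγ, hΨ⟩
  rcases eq_or_ne S 0 with rfl | hS0
  · have hγ0 : 0 < γ := hSγ.resolve_left fun h => h rfl
    refine not_hasOnlyRealZeros_pfSmoothing_gaussian hL hα hβ hC hγ0 fun s => ?_
    rw [hΨ s]; simp
  · intro hreal
    have hfun : (fun z : ℂ => ∫ y : ℝ, (Λ y : ℂ) * deBruijnH 0 (z - y)) =
        fun z => (C : ℂ)⁻¹ * ∫ u in Set.Ioi (0:ℝ), ((Real.exp (-(γ * u ^ 2)) * deBruijnPhi u /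
          (S.map fun b => 1 + u ^ 2 / b ^ 2).prod : ℝ) : ℂ) * Complex.cos (z * u) :=
      funext fun z => pfSmoothing_eq hL hα hβ hΨ z
    rw [hfun, hasOnlyRealZeros_const_mul_iff (inv_ne_zero (Complex.ofReal_ne_zero.2 hC.ne'))]
      at hreal
    exact hGN γ S hγ hS hS0 hreal

/-- **Reduction of the barrier to generalised Newman on the whole finite even cone.**  The
hypothesis is LITERALLY the right-hand side of the summit-side equivalence
`Summit.RiemannHypothesis.RiemannHypothesis.Theorems.UniversalFactor.not_laplaceLoophole_iff_universalFactorNewman`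
(whose left-hand side `¬ LaplaceLoophole` is the kernel-checked
`…Theorems.UniversalFactorLaplaceLoophole_refuted`), so that summit-side
`PolyaFrequencySmoothing_holds := PolyaFrequencySmoothing_of_universalFactorNewman (iff.mp refuted)`.
[folklore] -/
theorem PolyaFrequencySmoothing_of_universalFactorNewman
    (hGN : ∀ (t : ℝ) (s : Multiset ℝ), 0 ≤ t → (∀ b ∈ s, 0 < b) → (s ≠ 0 ∨ 0 < t) →
      ¬ HasOnlyRealZeros (fun z : ℂ => ∫ u in Set.Ioi (0:ℝ), ((Real.exp (-(t * u ^ 2)) *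
        deBruijnPhi u / (s.map fun b => 1 + u ^ 2 / b ^ 2).prod : ℝ) : ℂ) *
          Complex.cos (z * u))) :
    PolyaFrequencySmoothing :=
  PolyaFrequencySmoothing_of_laplaceRays fun t s ht hs hs0 => hGN t s ht hs (Or.inl hs0)

/-! ## Non-vacuity: the Gaussian meets every hypothesis of the barrier -/

/-- The hypotheses of `PolyaFrequencySmoothing` are satisfiable: the normal density `e^{−x²}` is
an even Pólya frequency function (`isPolyaFrequencyFun_gaussian`) whose reciprocal transform
`π^{−1/2} e^{−s²/4}` (`hasLaplaceTransformInvOn_gaussian`) is of finite even Schoenberg form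
(`C = π^{−1/2}`, `γ = 1/4`, `S = ∅`). [folklore] -/
theorem exists_hypotheses_polyaFrequencySmoothing :
    ∃ (Λ : ℝ → ℝ) (Ψ : ℂ → ℂ) (α β : ℝ), IsPolyaFrequencyFun Λ ∧ (∀ x, Λ (-x) = Λ x) ∧
      HasLaplaceTransformInvOn Λ Ψ α β ∧ α < 0 ∧ 0 < β ∧ HasFiniteEvenSchoenbergForm Ψ := by
  refine ⟨fun u => Real.exp (-1 * u ^ 2),
    fun s => ((Real.sqrt (Real.pi / 1))⁻¹ : ℝ) * Complex.exp (-(s ^ 2 / (4 * 1))), -1, 1,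
    ?_, fun x => ?_, hasLaplaceTransformInvOn_gaussian one_pos (-1) 1, by norm_num, one_pos, ?_⟩
  · simpa only [one_mul] using isPolyaFrequencyFun_gaussian (a := 1) (c := 1) one_pos one_pos
  · show Real.exp (-1 * (-x) ^ 2) = Real.exp (-1 * x ^ 2)
    rw [neg_sq]
  · refine ⟨(Real.sqrt (Real.pi / 1))⁻¹, 1 / 4, 0, ?_, by norm_num, by simp, Or.inr (by norm_num),
      fun s => ?_⟩
    · exact inv_pos.2 (Real.sqrt_pos.2 (by simpa using Real.pi_pos))
    · simp only [Multiset.map_zero, Multiset.prod_zero, mul_one]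
      have h4 : -(s ^ 2 / 4) = -(((1 / 4 : ℝ)) : ℂ) * s ^ 2 := by push_cast; ring
      rw [h4]

end Literature.Barriers.RiemannHypothesis

end
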